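import Literature.AlgebraicGeometry.Motives.JacobianGaloisDescent
import Literature.AlgebraicGeometry.Motives.HypersurfaceFieldPoints
import Literature.AlgebraicGeometry.Motives.ComplexPointsZariskiDense
import HarnessLib

/-!
# Galois stability of a reduced closed subscheme of `X ⊗_K L` from a Zariski-dense set of points

Topic `AlgebraicGeometry/Motives`; namespace `Literature.AlgebraicGeometry.Motives`. Theorems only (no
definition, no named fact, no `sorry`).

Let `K → L` be fields, `X` a `K`-scheme, `X_L = X ×_K Spec L` its base change
(`Motives.baseChange K L`, underlying scheme `GaloisDescent.bc L X`), `σ ∈ Aut(L/K)` and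
`gal σ = 1 × Spec σ⁻¹` the Galois automorphism of the scheme `X_L` (`GaloisDescent.gal`). The group
`Aut(L/K)` acts on the `L`-points `X(L)` of the `K`-scheme `X` (`AlgPoints.instMulActionAlgEquiv`,
`σ • P = Spec σ ≫ P`), and `X(L) ≃ X_L(L)` (`AlgPoints.baseChangeEquiv (algebraMap K L) X`; for a
subfield `E ⊆ ℂ` this is the cell's `UnitaryCanonicalModel.Aux.pointsOfForm`). For a closed
`L`-immersion `ι : Y → X_L` one asks whether the image `ι(Y(L)) ⊆ X(L)` is `Aut(L/K)`-stable — the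
hypothesis «`Y` stable sous `Aut(ℂ/E)`» of [Deligne1971TravauxShimura] Cor. 5.7 /
[Milne2005ShimuraVarieties] §13 p. 117, read on points.

* §1 `range_subset_range_of_dense_of_forall_mem_range` — if a morphism `ι' : Z' → W` sends a dense
  subset `T ⊆ Z'` into the (closed) range of a closed immersion `ι : Z → W`, then `range ι' ⊆ range ι`
  (pure topology: `ι'⁻¹(range ι)` is closed and contains `T`; no reducedness or quasi-compactness,
  unlike the factorisation `Morphisms.exists_fac_of_isClosedImmersion_of_dense` /
  `Morphisms.range_subset_range_of_dense` of `Morphisms/ClosedImmersionFactorOfDense`, which this file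
  does not need).
* §2 `AlgPoints.left_eq_specAut_comp_left_comp_gal_of_smul_eq`, `AlgPoints.pt_eq_gal_apply_pt_of_smul_eq`
  — the Galois action read through `X(L) ≃ X_L(L)` is `gal`: if `σ • Q = Q'` in `X(L)` for `L`-points
  `Q, Q'` of `X_L`, then `Q' = Spec σ ≫ Q ≫ gal σ` as morphisms `Spec L → X_L`, so `pt Q' = (gal σ)(pt Q)`.
* §3 `exists_smul_baseChangeEquiv_symm_map_eq_of_dense` — **the stability criterion**: if `ι : Y → X_L`
  is a closed `L`-immersion and, for ONE `σ ∈ Aut(L/K)`, every point `P` of a subset `T ⊆ Y(L)` WITH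
  ZARISKI-DENSE IMAGE IN `Y` satisfies `σ • ι(P) = ι(P₁)` in `X(L)` for some `P₁ ∈ Y(L)`, then EVERY
  `P ∈ Y(L)` does. Proof: on `T` the equation says `(gal σ)(ι(pt P)) = ι(pt P₁) ∈ range ι` (§2); by
  density and closedness `range (ι ≫ gal σ) ⊆ range ι` (§1); so for any `P` the `L`-point
  `Q' := Spec σ ≫ P ≫ ι ≫ gal σ` of `X_L`, which represents `σ • ι(P)` in `X(L)`, lies on the closed
  subscheme `Y` and lifts to `P₁ ∈ Y(L)` (`AlgPoints.liftClosed`: `Spec L` is reduced). Neither a Galois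
  twist `Y^σ` of `Y` nor reducedness of `Y` is needed.
* `exists_smul_baseChangeEquiv_symm_map_eq_of_dense_complexPoints` — the same over `K ⊆ ℂ` with `T`
  dense in the complex topology of `Y(ℂ)` (`Y` locally of finite type), via
  `Motives.dense_image_pt_of_dense` (complex-dense ⇒ Zariski-dense). This is the passage
  «`Aut(ℂ/E)`-stability at a dense set of special points ⇒ stability of the image» in the proof of
  [Deligne1971TravauxShimura] 5.2 / Cor. 5.7 (cell hodgecm-mathlib, row I-1′, stub S5
  `ImageStableOfReciprocity`, steps 4–6 of `B-plan/I1prime-S5-LEAVES.md` §0 in one statement: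
  `UnitaryCanonicalModel.Aux.pointsOfForm A` IS `AlgPoints.baseChangeEquiv (algebraMap ↥E ℂ) A`, so the
  `ImageStable` body is this theorem applied to `(K, L) := (↥E, ℂ)`, slot-tested by paste).

HC_CM is proved only modulo the 7 printed citations until rung 0 closes; this file proves no cell
binder (banked generic leaf toward hDel / I-1′, no floor change).

## References
* [Deligne1971TravauxShimura] P. Deligne, *Travaux de Shimura*, Sém. Bourbaki 389 (1971), 5.2 p. 155,
  Cor. 5.7 p. 156.
* [Milne2005ShimuraVarieties] J. S. Milne, *Introduction to Shimura varieties* (2005), §13 p. 117.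
* [StacksProject] The Stacks project, Tag 0356 (reduced induced closed subscheme), Tag 005U
  (Jacobson spaces).
* [GortzWedhorn2020] U. Görtz, T. Wedhorn, *Algebraic Geometry I* (2nd ed.), Prop. 3.35, §(14.20).
-/

noncomputable section

universe u

open CategoryTheory CategoryTheory.Limits AlgebraicGeometry Topology

namespace Literature.AlgebraicGeometry.Motives

set_option backward.isDefEq.respectTransparency false

/-! ### §1. Closed ranges and dense sets of points -/

section Range

variable {Z Z' W : Scheme.{u}} (ι : Z ⟶ W) (ι' : Z' ⟶ W)

/-- If `ι : Z → W` is a closed immersion and `ι' : Z' → W` maps a dense subset `T ⊆ Z'` into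
`range ι`, then `range ι' ⊆ range ι` (`ι'⁻¹(range ι)` is closed and contains `T`) — the topological
step of «stable on a dense set of points ⇒ stable» ([Deligne1971TravauxShimura] 5.2). No hypothesis on
`Z'` or `ι'`. [cite: Deligne1971TravauxShimura, 5.2 p. 155] -/
theorem range_subset_range_of_dense_of_forall_mem_range [IsClosedImmersion ι] (T : Set Z')
    (hT : Dense T) (h : ∀ z ∈ T, ι' z ∈ Set.range ι) : Set.range ι' ⊆ Set.range ι := by
  have hcl : IsClosed ((fun z : Z' => ι' z) ⁻¹' Set.range ι) :=
    ι.isClosedEmbedding.isClosed_range.preimage ι'.continuous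
  have hsub : closure T ⊆ (fun z : Z' => ι' z) ⁻¹' Set.range ι := closure_minimal h hcl
  rw [hT.closure_eq] at hsub
  rintro _ ⟨z, rfl⟩
  exact hsub (Set.mem_univ z)

end Range

/-! ### §2. The Galois action on `X(L) ≃ X_L(L)` moves underlying points by `gal` -/

section Galois

open AbelianVariety (bcSpec specAut specAut_comp_specAut_symm)

variable {K : Type u} [Field K] {L : Type u} [Field L] [Algebra K L] (X : SchemeOver K)

/-- An `L`-point `Q` of the `L`-scheme `X_L = X ×_K Spec L` (a section over `Spec L`) composes with
the structure map `X_L → Spec L` (the second projection) to the identity.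
[cite: GortzWedhorn2020, §(4.8) and Prop. 4.16] -/
theorem AlgPoints.left_comp_snd_eq_id (Q : AlgPoints ((Motives.baseChange K L).obj X) L) :
    Q.left ≫ pullback.snd X.hom (bcSpec K L) = 𝟙 _ := by
  have h := Over.w Q
  change Q.left ≫ pullback.snd X.hom (bcSpec K L) = Spec.map (CommRingCat.ofHom (algebraMap L L))
    at h
  rw [h, Algebra.algebraMap_self, CommRingCat.ofHom_id, Spec.map_id]
  rfl

/-- **The Galois action read through `X(L) ≃ X_L(L)` is `gal`** (point bookkeeping): if
`σ • Q = Q'` in `X(L)` for `L`-points `Q, Q'` of `X_L` (transported by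
`(AlgPoints.baseChangeEquiv (algebraMap K L) X).symm`, i.e. composed with `pr : X_L → X`), then as
morphisms `Spec L → X_L` one has `Q' = Spec σ ≫ Q ≫ gal σ` (`gal σ = 1 × Spec σ⁻¹`).
[cite: GortzWedhorn2020, §(14.20)] [cite: Milne2005ShimuraVarieties, §13 p. 117] -/
theorem AlgPoints.left_eq_specAut_comp_left_comp_gal_of_smul_eq (σ : L ≃ₐ[K] L)
    (Q Q' : AlgPoints ((Motives.baseChange K L).obj X) L)
    (h : σ • ((AlgPoints.baseChangeEquiv (algebraMap K L) X).symm Q : AlgPoints X L) =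
      (AlgPoints.baseChangeEquiv (algebraMap K L) X).symm Q') :
    Q'.left = specAut L σ ≫ Q.left ≫ GaloisDescent.gal L X σ := by
  have e : (σ • ((AlgPoints.baseChangeEquiv (algebraMap K L) X).symm Q : AlgPoints X L)).left =
      ((AlgPoints.baseChangeEquiv (algebraMap K L) X).symm Q').left := by rw [h]
  rw [AlgPoints.smul_left, AlgPoints.baseChangeEquiv_symm_apply_left,
    AlgPoints.baseChangeEquiv_symm_apply_left] at e
  dsimp only [baseChangeHomFst] at e
  apply pullback.hom_ext
  · -- first projection: the given equation
    simp only [Category.assoc]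
    rw [GaloisDescent.gal_fst]
    exact e.symm
  · -- second projection: both sides are `L`-points over `L`
    simp only [Category.assoc]
    rw [GaloisDescent.gal_snd, AlgPoints.left_comp_snd_eq_id X Q',
      reassoc_of% (AlgPoints.left_comp_snd_eq_id X Q), specAut_comp_specAut_symm]
    rfl

/-- Point form of `AlgPoints.left_eq_specAut_comp_left_comp_gal_of_smul_eq`: if `σ • Q = Q'` in
`X(L)` then the underlying point of `Q'` in `X_L` is `(gal σ)` of that of `Q`.
[cite: GortzWedhorn2020, §(14.20)] -/
theorem AlgPoints.pt_eq_gal_apply_pt_of_smul_eq (σ : L ≃ₐ[K] L)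
    (Q Q' : AlgPoints ((Motives.baseChange K L).obj X) L)
    (h : σ • ((AlgPoints.baseChangeEquiv (algebraMap K L) X).symm Q : AlgPoints X L) =
      (AlgPoints.baseChangeEquiv (algebraMap K L) X).symm Q') :
    Q'.pt = GaloisDescent.gal L X σ Q.pt := by
  -- `AlgPoints.pt R = R.left (closedPoint L)` definitionally
  change Q'.left (IsLocalRing.closedPoint L) =
    GaloisDescent.gal L X σ (Q.left (IsLocalRing.closedPoint L))
  rw [AlgPoints.left_eq_specAut_comp_left_comp_gal_of_smul_eq X σ Q Q' h]
  simp only [Scheme.Hom.comp_apply]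
  exact congrArg (fun c => GaloisDescent.gal L X σ (Q.left c))
    (Subsingleton.elim (α := PrimeSpectrum L) _ _)

variable {X}

/-! ### §3. `Aut(L/K)`-stability of the image of a closed immersion into `X_L` -/

/-- **`Aut(L/K)`-stability of the image of a closed immersion from a Zariski-dense set of points**
([Deligne1971TravauxShimura] 5.2 / Cor. 5.7 hypothesis «`Y` stable sous `Aut`», on points;
[Milne2005ShimuraVarieties] §13). Let `ι : Y → X_L` be a closed `L`-immersion, `σ ∈ Aut(L/K)`, and
`T ⊆ Y(L)` a set of `L`-points whose underlying points are dense in `Y`. If for every `P ∈ T` the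
point `σ • ι(P)` of `X(L)` (the action of `Aut(L/K)` on `X(L) ≃ X_L(L)`, `AlgPoints.baseChangeEquiv`)
is again of the form `ι(P₁)`, `P₁ ∈ Y(L)`, then the same holds for EVERY `P ∈ Y(L)`. Proof: on `T`
the hypothesis gives `(gal σ)(ι(pt P)) ∈ range ι` (`pt_eq_gal_apply_pt_of_smul_eq`), hence
`range (ι ≫ gal σ) ⊆ range ι` by density and closedness (§1); for any `P` the `L`-point
`Q' := Spec σ ≫ P ≫ ι ≫ gal σ` of `X_L` represents `σ • ι(P)` and lies on `range ι`, so it lifts to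
`P₁ ∈ Y(L)` (`AlgPoints.liftClosed`). No reducedness of `Y` and no Galois twist of `Y` is used.
[cite: Deligne1971TravauxShimura, 5.2 p. 155, Cor. 5.7 p. 156] [cite: Milne2005ShimuraVarieties, §13 p. 117] -/
theorem exists_smul_baseChangeEquiv_symm_map_eq_of_dense {Y : SchemeOver L}
    (ι : Y ⟶ (Motives.baseChange K L).obj X) [IsClosedImmersion ι.left]
    (σ : L ≃ₐ[K] L) {T : Set (AlgPoints Y L)} (hT : Dense (AlgPoints.pt '' T : Set Y.left))
    (h : ∀ P ∈ T, ∃ P₁ : AlgPoints Y L,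
      σ • ((AlgPoints.baseChangeEquiv (algebraMap K L) X).symm (AlgPoints.map ι P) : AlgPoints X L) =
        (AlgPoints.baseChangeEquiv (algebraMap K L) X).symm (AlgPoints.map ι P₁))
    (P : AlgPoints Y L) :
    ∃ P₁ : AlgPoints Y L,
      σ • ((AlgPoints.baseChangeEquiv (algebraMap K L) X).symm (AlgPoints.map ι P) : AlgPoints X L) =
        (AlgPoints.baseChangeEquiv (algebraMap K L) X).symm (AlgPoints.map ι P₁) := by
  -- (1) on the dense set, `gal σ ∘ ι` lands in `range ι`
  have hrange : ∀ z ∈ (AlgPoints.pt '' T : Set Y.left),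
      (ι.left ≫ GaloisDescent.gal L X σ) z ∈ Set.range ι.left := by
    rintro _ ⟨P₀, hP₀, rfl⟩
    obtain ⟨P₁, hP₁⟩ := h P₀ hP₀
    refine ⟨P₁.pt, ?_⟩
    have hpt := AlgPoints.pt_eq_gal_apply_pt_of_smul_eq X σ (AlgPoints.map ι P₀)
      (AlgPoints.map ι P₁) hP₁
    rw [AlgPoints.pt_map, AlgPoints.pt_map] at hpt
    rw [Scheme.Hom.comp_apply]
    exact hpt
  -- (2) hence everywhere (closedness of `range ι`, density of `pt '' T`)
  have hall : Set.range (ι.left ≫ GaloisDescent.gal L X σ) ⊆ Set.range ι.left :=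
    range_subset_range_of_dense_of_forall_mem_range ι.left _ _ hT hrange
  -- (3) the `L`-point `Q' := Spec σ ≫ P ≫ ι ≫ gal σ` of `X_L` (over `L`)
  have hsnd : P.left ≫ ι.left ≫ pullback.snd X.hom (bcSpec K L) = 𝟙 _ := by
    have hR := AlgPoints.left_comp_snd_eq_id X (AlgPoints.map ι P)
    rw [AlgPoints.map_apply, Over.comp_left, Category.assoc] at hR
    exact hR
  have hw : (specAut L σ ≫ P.left ≫ ι.left ≫ GaloisDescent.gal L X σ) ≫
      ((Motives.baseChange K L).obj X).hom = (specOver L L).hom := by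
    rw [← Over.w (AlgPoints.map ι P), AlgPoints.map_apply, Over.comp_left]
    change (specAut L σ ≫ P.left ≫ ι.left ≫ GaloisDescent.gal L X σ) ≫
        pullback.snd X.hom (bcSpec K L) = (P.left ≫ ι.left) ≫ pullback.snd X.hom (bcSpec K L)
    simp only [Category.assoc]
    rw [hsnd, GaloisDescent.gal_snd, reassoc_of% hsnd, specAut_comp_specAut_symm]
    rfl
  -- (4) it lies on the closed subscheme `Y`: lift it
  have hpt : (AlgPoints.mk _ hw).pt ∈ Set.range ι.left := by
    refine hall ⟨P.pt, ?_⟩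
    -- `AlgPoints.pt R = R.left (closedPoint L)` definitionally
    change (ι.left ≫ GaloisDescent.gal L X σ) (P.left (IsLocalRing.closedPoint L)) =
      (specAut L σ ≫ P.left ≫ ι.left ≫ GaloisDescent.gal L X σ) (IsLocalRing.closedPoint L)
    simp only [Scheme.Hom.comp_apply]
    exact congrArg (fun c => GaloisDescent.gal L X σ (ι.left (P.left c)))
      (Subsingleton.elim (α := PrimeSpectrum L) _ _)
  refine ⟨(AlgPoints.mk _ hw).liftClosed ι hpt, ?_⟩
  rw [AlgPoints.map_liftClosed]
  -- (5) the equation, on underlying morphisms `Spec L → X`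
  ext : 1
  rw [AlgPoints.smul_left, AlgPoints.baseChangeEquiv_symm_apply_left,
    AlgPoints.baseChangeEquiv_symm_apply_left, AlgPoints.map_apply, Over.comp_left]
  change specAut L σ ≫ (P.left ≫ ι.left) ≫ pullback.fst X.hom (bcSpec K L) =
    (specAut L σ ≫ P.left ≫ ι.left ≫ GaloisDescent.gal L X σ) ≫ pullback.fst X.hom (bcSpec K L)
  simp only [Category.assoc]
  rw [GaloisDescent.gal_fst]

/-- **`Aut(ℂ/K)`-stability of the image from a set of complex points dense in the complex topology**
(`K ⊆ ℂ`, `Y` locally of finite type over `ℂ`): as `exists_smul_baseChangeEquiv_symm_map_eq_of_dense`,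
with `T ⊆ Y(ℂ)` dense in `Y(ℂ)` (complex-dense ⇒ Zariski-dense, `Motives.dense_image_pt_of_dense`).
For `K = E` and `Y` a complex Shimura variety embedded in `A ⊗_E ℂ` this is «reciprocity at the
(dense) special points ⇒ the image is `Aut(ℂ/E)`-stable» of [Deligne1971TravauxShimura] 5.2 /
Cor. 5.7 (cell row I-1′ S5: `UnitaryCanonicalModel.Aux.pointsOfForm A` is
`AlgPoints.baseChangeEquiv (algebraMap ↥E ℂ) A` by `rfl`, so `ImageStable` is this statement).
[cite: Deligne1971TravauxShimura, 5.2 p. 155, Cor. 5.7 p. 156] [cite: Milne2005ShimuraVarieties, §13 p. 117] -/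
theorem exists_smul_baseChangeEquiv_symm_map_eq_of_dense_complexPoints {K : Type} [Field K]
    [Algebra K ℂ] {X : SchemeOver K} {Y : SchemeOver ℂ} [LocallyOfFiniteType Y.hom]
    (ι : Y ⟶ (Motives.baseChange K ℂ).obj X) [IsClosedImmersion ι.left]
    (σ : ℂ ≃ₐ[K] ℂ) {T : Set (ComplexPoints Y)} (hT : Dense T)
    (h : ∀ P ∈ T, ∃ P₁ : ComplexPoints Y,
      σ • ((AlgPoints.baseChangeEquiv (algebraMap K ℂ) X).symm (AlgPoints.map ι P) : ComplexPoints X) =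
        (AlgPoints.baseChangeEquiv (algebraMap K ℂ) X).symm (AlgPoints.map ι P₁))
    (P : ComplexPoints Y) :
    ∃ P₁ : ComplexPoints Y,
      σ • ((AlgPoints.baseChangeEquiv (algebraMap K ℂ) X).symm (AlgPoints.map ι P) : ComplexPoints X) =
        (AlgPoints.baseChangeEquiv (algebraMap K ℂ) X).symm (AlgPoints.map ι P₁) :=
  exists_smul_baseChangeEquiv_symm_map_eq_of_dense ι σ (dense_image_pt_of_dense hT) h P

end Galois

end Literature.AlgebraicGeometry.Motives

end
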